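import Summits.ABC.IUTFork.Joshi.TensorPacketsJoshi
import Mathlib.LinearAlgebra.PiTensorProduct.DirectSum
import Mathlib.Algebra.DirectSum.Module
import Mathlib.LinearAlgebra.Multilinear.Basic
import HarnessLib

/-!
# [J-III] §9.4 — Joshi's construction of Mochizuki's tensor-packet codomain, II: res/cores, `𝓘_Joshi`, Prop. 9.4.9.3,
# (9.4.10.1) (block E of the abc-iut cell, rung LADDER-ABC:A2.E, slot T-20 = seat abc-iut-E-t20)

Sequel of `Summits/ABC/IUTFork/Joshi/TensorPacketsJoshi.lean` (same source, conventions, carriers and flags F1–F6: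
K. Joshi, arXiv:2401.13508 **v4**, bib `Joshi2024ATS3`, render `HOME/lit/renders/Joshi-arxiv-2401.13508/`, "p.N l.a–b").
THIS FILE types, over the unbundled log-shell carriers `IQ : 𝔇.Arith → T.V → Type` and OUR `Thm311.ThetaIndex`:
§1 [J-III] Prop. 9.4.2.4 (2)–(4) (p.101 l.51–73) — restriction / corestriction / "multiplication by the local degree"
— as a HYPOTHESIS (`CoresResDegree`, `@[claim "Joshi2024ATS3" "disputed"]`; the maps and degrees are parameters,
never asserted; merge-debt slot T-21); §2 Rmk. 9.4.6.9 / (9.4.6.10) (p.104 l.65–70) — the induced maps on the packets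
`^{S_{j+1}}𝓘^{ℚ_p}_p(L')` (`packetMap`, = the shape of OUR `LogShells.factorwise ∘ summandwise`) and "the appearance of
certain powers in each factor", PROVED on pure tensors from the hypothesis (`packetMap_cores_res_tprod`, `_pow`);
§3 §9.4.8–9.4.9 (pp.105–106) — `𝓘_Joshi ⊂ 𝓘^ℚ_Joshi` ((9.4.8.1), `A = {1,…,ℓ*}` = OUR `T.LabelStar`), Rmk. 9.4.8.2 /
(9.4.8.3) "forgetting the `y_j`" as a linear equivalence CONSTRUCTED from the amphoric isomorphisms `𝓘_{p,y_j} ≃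
𝓘_{p,y_{ℓ*}}` taken as a PARAMETER `amph` (Prop. 9.2.1.5 is slot T-19's; nothing asserted), the product variant
`𝓘̃_Joshi` ((9.4.9.1)), the projection `𝓘̃_Mochizuki ↠ 𝓘̃_Joshi` "onto the `(j+1)`th factor of each `S_{j+1}`" (p.106
l.21–27; = OUR `ThetaIndex.selfIndex j`), and Prop. 9.4.9.3 ((9.4.9.4)/(9.4.9.5)) PROVED as linear equivalences
(`prodIQJoshiEquiv`, `prop9493Equiv`); §4 (9.4.10.1) (p.106 l.61–86) — the `(j+1)`-fold tensor product distributes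
over the finite direct sums `⊕_{w∈V_p}` (`packetQDecomposition`, PROVED; twin of OUR
`Literature.IUT.LogThetaLattice.packetDecomposition`; the further splitting of each summand into p-adic FIELDS
"`⊕_α E''_α` … a multi-set of p-adic fields" is [IUTchIII] Prop. 3.1 (i) = `Prop31i_ringStructures`, named there).
Rmk. 9.4.8.2's sentence "keeping the `z_Θ` components … allows us to remember that the individual factors come
equipped with the valuation scaling property given by Theorem 4.2.2.1. This property is crucial for establishing
[Mochizuki, 2021c, Corollary 3.12]" (p.105 l.66–69) names exactly what the strictification dictionary D-09 of the
first file forgets — E-PLAN §2's load-bearing question for E-cx (do OUR (Ind1)/(Ind2) contain valuation-rescaling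
moves?); it is recorded here, not adjudicated (Thm. 4.2.2.1 is slot T-07's). Rmk. 9.4.9.6 (p.106 l.55–60: the locus
"may also be defined in the product versions") and Rmk. 9.4.10.2 (p.106 l.87 – p.107 l.3: "tensor packet structure
… is to compensate for the missing ring structure") are readings without objects. TAKES NO SIDE on [IUTchIII] Cor.
3.12, on Joshi's claims, or on Mochizuki's report on them; typed ≠ proved; typed AS A CANDIDATE ≠ endorsed; the cell
locates / conditionally verifies — NO abc claim. Deliberately NOT here: `Θ̃^𝓘` (§9.8, T-22), any TEST against S.
-/

noncomputable section

namespace Summit.ABC.IUTFork.Joshi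

open Thm311 Literature.IUT.LogThetaLattice
open scoped TensorProduct

variable {T : ThetaIndex}

namespace TensorPacketDatum

variable (𝔇 : TensorPacketDatum T)

section Carriers

variable (𝕜 : Type) [Field 𝕜]
variable (IQ : 𝔇.Arith → T.V → Type) [∀ y w, AddCommGroup (IQ y w)] [∀ y w, Module 𝕜 (IQ y w)]
variable (I : ∀ (y : 𝔇.Arith) (w : T.V), AddSubgroup (IQ y w))

/-! ## 1. Prop. 9.4.2.4 (2)–(4): restriction, corestriction, local degrees (HYPOTHESIS, as printed) -/

section ResCores

variable (MQ : 𝔇.Arith → T.V → Type) [∀ y v, AddCommGroup (MQ y v)] [∀ y v, Module 𝕜 (MQ y v)]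
variable (res : ∀ (y : 𝔇.Arith) (w : T.V), MQ y w →ₗ[𝕜] IQ y w)
variable (cores : ∀ (y : 𝔇.Arith) (w : T.V), IQ y w →ₗ[𝕜] MQ y w) (deg : T.V → ℕ)

/-- [J-III] Proposition 9.4.2.4 (2)–(4) (p.101 l.51–73), over an `L_mod`-level carrier `MQ y v =
H^1_e(arith(L_mod)_y)_v` (`v ∈ V_{L_mod} ≃ V`): "(2) … the restriction homomorphism … which on each local factor is
the restriction homomorphism on Galois cohomology. (3) … the corestriction homomorphism … (4) The composite of
restriction and corestriction is multiplication by the local degree `[L'_w : L_{mod,v}]` … i.e. `(q_v) ↦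
cores(res(q_v))` is the mapping `(q_v) ↦ (q_v^{[L'_w : L_{mod,v}]})`" (additively here). HYPOTHESIS: `res`, `cores`,
`deg` are parameters and (4) is this `Prop` ("standard properties of Galois cohomology", p.102 l.1–2); merge-debt
slot T-21. [claim: Joshi2024ATS3, status: disputed] -/
@[claim "Joshi2024ATS3" "disputed"]
def CoresResDegree (y : 𝔇.Arith) : Prop := ∀ (w : T.V) (x : MQ y w), cores y w (res y w x) = deg w • x

/-- The adelic restriction of Prop. 9.4.2.4 (2) (p.101 l.51–57): the product over `w ∈ V` of the local
restrictions. [claim: Joshi2024ATS3, status: disputed] -/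
def adelicRes (y : 𝔇.Arith) : 𝔇.adelicH1eQ MQ y →ₗ[𝕜] 𝔇.adelicH1eQ IQ y :=
  LinearMap.pi fun w => (res y w).comp (LinearMap.proj w)

/-- The adelic corestriction of Prop. 9.4.2.4 (3) (p.101 l.58–65). [claim: Joshi2024ATS3, status: disputed] -/
def adelicCores (y : 𝔇.Arith) : 𝔇.adelicH1eQ IQ y →ₗ[𝕜] 𝔇.adelicH1eQ MQ y :=
  LinearMap.pi fun w => (cores y w).comp (LinearMap.proj w)

/-- Prop. 9.4.2.4 (4), adelic form (p.101 l.66–73): under the hypothesis `CoresResDegree`, the composite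
`cores ∘ res` multiplies the `w`-component by the local degree `[L'_w : L_{mod,v}]`. PROVED from the
hypothesis. [claim: Joshi2024ATS3, status: disputed] -/
theorem adelicCores_adelicRes (y : 𝔇.Arith) (h : 𝔇.CoresResDegree 𝕜 IQ MQ res cores deg y)
    (x : 𝔇.adelicH1eQ MQ y) :
    𝔇.adelicCores 𝕜 IQ MQ cores y (𝔇.adelicRes 𝕜 IQ MQ res y x) = fun w => deg w • x w := by
  funext w
  exact h w (x w)

end ResCores

/-! ## 2. Rmk. 9.4.6.9: restriction / corestriction on the packets and "the appearance of certain powers" -/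

section Functorial

variable {IQ}
variable {IQ' : 𝔇.Arith → T.V → Type} [∀ y w, AddCommGroup (IQ' y w)] [∀ y w, Module 𝕜 (IQ' y w)]

/-- Functoriality of `^{S_{j+1}}𝓘^{ℚ_p}_p(L')` in the log-shell carriers: a family of local maps
`f_{y,w} : 𝓘^{ℚ_p}(L'_w)_y → 𝓘'^{ℚ_p}(L'_w)_y` induces `⊗_a (⊕_w f_{z_a,w})` — the shape of the maps `res`, `cores`
of Rmk. 9.4.6.9 (9.4.6.10) (p.104 l.65–67) on each packet, and of OUR `LogShells.factorwise ∘ summandwise`.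
[folklore] -/
def packetMap (f : ∀ (y : 𝔇.Arith) (w : T.V), IQ y w →ₗ[𝕜] IQ' y w) (z : T.Label → 𝔇.Arith) (j : T.Label)
    (p : T.VQ) : 𝔇.packetQ 𝕜 IQ z j p →ₗ[𝕜] 𝔇.packetQ 𝕜 IQ' z j p :=
  PiTensorProduct.map fun a =>
    LinearMap.pi fun w : T.Fibre p => (f (𝔇.capsEntry z j a) w.1).comp (LinearMap.proj w)

/-- `packetMap f` on a pure tensor: `⊗_a (x_{a,w})_w ↦ ⊗_a (f_{z_a,w} x_{a,w})_w`. [folklore] -/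
theorem packetMap_tprod (f : ∀ (y : 𝔇.Arith) (w : T.V), IQ y w →ₗ[𝕜] IQ' y w) (z : T.Label → 𝔇.Arith)
    (j : T.Label) (p : T.VQ) (x : 𝔇.prodPacketQ IQ z j p) :
    𝔇.packetMap 𝕜 f z j p (PiTensorProduct.tprod 𝕜 x) =
      PiTensorProduct.tprod 𝕜 fun a (w : T.Fibre p) => f (𝔇.capsEntry z j a) w.1 (x a w) := by
  rw [packetMap, PiTensorProduct.map_tprod]
  rfl

end Functorial

section ResCoresPackets

variable (MQ : 𝔇.Arith → T.V → Type) [∀ y v, AddCommGroup (MQ y v)] [∀ y v, Module 𝕜 (MQ y v)]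
variable (res : ∀ (y : 𝔇.Arith) (w : T.V), MQ y w →ₗ[𝕜] IQ y w)
variable (cores : ∀ (y : 𝔇.Arith) (w : T.V), IQ y w →ₗ[𝕜] MQ y w) (deg : T.V → ℕ)

/-- [J-III] Remark 9.4.6.9 (p.104 l.65–70): for "`𝓘_Mochizuki(L_mod) →res→ 𝓘_Mochizuki(L') →cores→
𝓘_Mochizuki(L_mod)`" ((9.4.6.10)), "The composite, by Proposition 9.4.2.4, leads to the appearance of certain
powers in each factor which will become important in the definition of weighted adelic volumes here in §9.10.3
and in [Mochizuki, 2021c, Section 3]" — PROVED on pure tensors from the hypothesis Prop. 9.4.2.4 (4): the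
`(a, w)`-component is multiplied by the local degree `[L'_w : L_{mod,v}]`. [claim: Joshi2024ATS3, status: disputed] -/
theorem packetMap_cores_res_tprod (h : ∀ y : 𝔇.Arith, 𝔇.CoresResDegree 𝕜 IQ MQ res cores deg y)
    (z : T.Label → 𝔇.Arith) (j : T.Label) (p : T.VQ) (x : 𝔇.prodPacketQ MQ z j p) :
    𝔇.packetMap 𝕜 cores z j p (𝔇.packetMap 𝕜 res z j p (PiTensorProduct.tprod 𝕜 x)) =
      PiTensorProduct.tprod 𝕜 fun a (w : T.Fibre p) => deg w.1 • x a w := by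
  rw [packetMap_tprod, packetMap_tprod]
  congr 1
  funext a w
  exact h _ w.1 (x a w)

/-- Rmk. 9.4.6.9, the "powers" made explicit: if all `w ∈ V_p` have the same local degree `d` over `L_mod`, the
composite `cores ∘ res` acts on the pure tensors of the `(j+1)`-fold packet `^{S_{j+1}}𝓘^{ℚ_p}_p` as multiplication
by `d^{j+1}` — PROVED from the hypothesis Prop. 9.4.2.4 (4). [claim: Joshi2024ATS3, status: disputed] -/
theorem packetMap_cores_res_tprod_pow (h : ∀ y : 𝔇.Arith, 𝔇.CoresResDegree 𝕜 IQ MQ res cores deg y)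
    (z : T.Label → 𝔇.Arith) (j : T.Label) (p : T.VQ) (d : ℕ) (hd : ∀ w : T.Fibre p, deg w.1 = d)
    (x : 𝔇.prodPacketQ MQ z j p) :
    𝔇.packetMap 𝕜 cores z j p (𝔇.packetMap 𝕜 res z j p (PiTensorProduct.tprod 𝕜 x)) =
      (d : 𝕜) ^ ((j : ℕ) + 1) • PiTensorProduct.tprod 𝕜 x := by
  rw [𝔇.packetMap_cores_res_tprod 𝕜 IQ MQ res cores deg h]
  have hx : (fun a (w : T.Fibre p) => deg w.1 • x a w) = fun a => (d : 𝕜) • x a := by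
    funext a w
    rw [hd w, Pi.smul_apply, Nat.cast_smul_eq_nsmul]
  rw [hx, MultilinearMap.map_smul_univ, Finset.prod_const, Finset.card_univ, Fintype.card_fin]

end ResCoresPackets

/-! ## 3. §9.4.8–9.4.9: the simpler codomains `𝓘_Joshi ⊂ 𝓘^ℚ_Joshi`, `𝓘̃_Joshi`, the projection, Prop. 9.4.9.3 -/

/-- `𝓘^ℚ_Joshi = ∏_p ( ⊗_{j=1}^{ℓ*} 𝓘^ℚ_{p,y_j} )` (§9.4.8, (9.4.8.1) right-hand side, p.105 l.30–52: "Let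
`z_Θ = (y_1,…,y_{ℓ*})` be the standard point of Mochizuki's Ansatz constructed in 4.5. This point is a
`Θ_gau`-Link in the terminology of [Mochizuki, 2021a,b,c]. Taking `A = {1,…,ℓ*}` in Mochizuki's construction"),
with `y_j` the `j`-th entry (`j ≥ 1`) of the tuple `z_Θ` (flag F6) and `A = {1,…,ℓ*}` = OUR `T.LabelStar`.
[claim: Joshi2024ATS3, status: disputed] -/
abbrev IQJoshi : Type :=
  ∀ p : T.VQ, MPacketN 𝕜 fun (j : T.LabelStar) (w : T.Fibre p) => IQ (𝔇.zTheta j.1) w.1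

/-- `𝓘_Joshi = ∏_p ( ⊗_{j=1}^{ℓ*} 𝓘_{p,y_j} ) ⊂ 𝓘^ℚ_Joshi` ((9.4.8.1), p.105 l.34–52), the integral structure generated
by pure tensors of shell elements (flag F2). [claim: Joshi2024ATS3, status: disputed] -/
def IJoshi : AddSubgroup (𝔇.IQJoshi 𝕜 IQ) :=
  AddSubgroup.pi Set.univ fun p =>
    shellPacketN 𝕜 (fun (j : T.LabelStar) (w : T.Fibre p) => IQ (𝔇.zTheta j.1) w.1)
      fun j w => I (𝔇.zTheta j.1) w.1

/-- [J-III] Remark 9.4.8.2 / (9.4.8.3) (p.105 l.53–66): "By Proposition 9.2.1.5 the log-shells are amphoric.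
Hence one has abstract isomorphisms `𝓘_{p,y_j} ≃ 𝓘_{p,y_{ℓ*}}` for `j = 1,…,ℓ*`, so one can write
`𝓘_Joshi = ∏_p ( ⊗_{j=1}^{ℓ*} 𝓘_p )` obtained by forgetting the `y_j` (or any arithmeticoids giving rise to a
specific log-shell) altogether (as [Mochizuki, 2021a,b,c] does)." The amphoric isomorphisms are a PARAMETER
`amph` (supplied by slot T-19's Prop. 9.2.1.5; nothing asserted here); the "forgetting" identification is then
this linear equivalence — CONSTRUCTED. What it forgets ("keeping the `z_Θ` components … allows us to remember
that the individual factors come equipped with the valuation scaling property given by Theorem 4.2.2.1. This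
property is crucial for establishing [Mochizuki, 2021c, Corollary 3.12]", p.105 l.66–69) is not typed here
(slot T-07). [claim: Joshi2024ATS3, status: disputed] -/
def IQJoshi.forget
    (amph : ∀ (j : T.LabelStar) (w : T.V), IQ (𝔇.zTheta j.1) w ≃ₗ[𝕜] IQ (𝔇.zTheta (lstarLabel T).1) w) :
    𝔇.IQJoshi 𝕜 IQ ≃ₗ[𝕜]
      (∀ p : T.VQ, ⨂[𝕜] _j : T.LabelStar, 𝔇.localPacketQ IQ (𝔇.zTheta (lstarLabel T).1) p) :=
  LinearEquiv.piCongrRight fun p =>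
    PiTensorProduct.congr fun j => LinearEquiv.piCongrRight fun w : T.Fibre p => amph j w.1

/-- `𝓘̃^ℚ_Joshi = ∏_p ( ∏_{j=1}^{ℓ*} 𝓘^ℚ_{p,y_j} )` (§9.4.9, (9.4.9.1) right-hand side, p.105 l.70–91: "the product
(instead of tensor product) variants … in the style of (9.4.6.3) and (9.4.6.4)"; Mochizuki-style (9.4.9.2),
p.106 l.1–20), typed for a tuple `z` with `y_j := z_j` = the entry at "the `(j+1)`th factor of each `S_{j+1}`"
(p.106 l.27; `capsEntry_selfIndex`), so that the projection below is literally a coordinate projection.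
[claim: Joshi2024ATS3, status: disputed] -/
abbrev prodIQJoshiAt (z : T.Label → 𝔇.Arith) : Type :=
  ∀ (p : T.VQ) (j : T.LabelStar), 𝔇.localPacketQ IQ (𝔇.capsEntry z j.1 (T.selfIndex j.1)) p

/-- `𝓘̃_Joshi = ∏_p ( ∏_{j=1}^{ℓ*} 𝓘_{p,y_j} ) ⊂ 𝓘̃^ℚ_Joshi` ((9.4.9.1), p.105 l.73–91), for the tuple `z`.
[claim: Joshi2024ATS3, status: disputed] -/
def prodIJoshiAt (z : T.Label → 𝔇.Arith) : AddSubgroup (𝔇.prodIQJoshiAt IQ z) :=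
  AddSubgroup.pi Set.univ fun p => AddSubgroup.pi Set.univ fun j =>
    𝔇.localPacket IQ I (𝔇.capsEntry z j.1 (T.selfIndex j.1)) p

/-- The natural projection `𝓘̃^ℚ_Mochizuki ↠ 𝓘̃^ℚ_Joshi` (§9.4.9, p.106 l.21–27: "obtained by projection onto the
`(j+1)`th factor of each `S_{j+1}` for `j = 1,…,ℓ*`") — the `(j+1)`th factor being the index `j ∈ S_{j+1}` = OUR
`ThetaIndex.selfIndex j` (the distinguished capsule index of [IUTchIII] Prop. 3.1 (ii)/3.2, `LogShells.SubPacket`).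
[claim: Joshi2024ATS3, status: disputed] -/
def projJoshi (z : T.Label → 𝔇.Arith) : 𝔇.prodIQMochizukiAt IQ z →ₗ[𝕜] 𝔇.prodIQJoshiAt IQ z where
  toFun x p j := x p j (T.selfIndex j.1)
  map_add' _ _ := rfl
  map_smul' _ _ := rfl

/-- The projection is surjective ("`↠`", p.106 l.22–26) — PROVED (extend by zero off the `(j+1)`th factor). [folklore] -/
theorem projJoshi_surjective (z : T.Label → 𝔇.Arith) : Function.Surjective (𝔇.projJoshi 𝕜 IQ z) := by
  intro y
  refine ⟨fun p j => Function.update 0 (T.selfIndex j.1) (y p j), ?_⟩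
  funext p j
  exact Function.update_self _ _ _

/-- `𝓘̃_Mochizuki ↠ 𝓘̃_Joshi` (p.106 l.22): the projection carries the integral product variant into the integral
one — PROVED. [folklore] -/
theorem projJoshi_mem (z : T.Label → 𝔇.Arith) (x : 𝔇.prodIQMochizukiAt IQ z) (hx : x ∈ 𝔇.prodIMochizukiAt IQ I z) :
    𝔇.projJoshi 𝕜 IQ z x ∈ 𝔇.prodIJoshiAt IQ I z := by
  simp only [prodIMochizukiAt, prodIJoshiAt, prodPacket, AddSubgroup.mem_pi, Set.mem_univ, true_implies]
    at hx ⊢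
  exact fun p j => hx p j (T.selfIndex j.1)

/-- The swap `∏_p ∏_j ≃ ∏_j ∏_p` used in Prop. 9.4.9.3. [folklore] -/
def prodSwap (z : T.Label → 𝔇.Arith) : 𝔇.prodIQJoshiAt IQ z ≃ₗ[𝕜]
    (∀ (j : T.LabelStar) (p : T.VQ), 𝔇.localPacketQ IQ (𝔇.capsEntry z j.1 (T.selfIndex j.1)) p) where
  toFun x j p := x p j
  invFun x p j := x j p
  left_inv _ := rfl
  right_inv _ := rfl
  map_add' _ _ := rfl
  map_smul' _ _ := rfl

/-- [J-III] Proposition 9.4.9.3, the equality halves of (9.4.9.4)/(9.4.9.5) (p.106 l.28–54): "Using Proposition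
9.4.2.4 one may identify `𝓘̃_Joshi` and `𝓘̃^ℚ_Joshi` as `ℓ*`-tuples of Galois cohomology classes of the `ℓ*`-tuple
of arithmeticoids `arith(L')_{z_Θ} = (arith(L')_{y_1},…,arith(L')_{y_{ℓ*}})` … explicitly as
`𝓘̃^ℚ_Joshi = ∏_{j=1}^{ℓ*} H^1_e(arith(L')_{y_j}, ℚ(1))`" — PROVED as a linear equivalence (swap, then Prop.
9.4.2.4 (1) factorwise), for any tuple `z`. [claim: Joshi2024ATS3, status: disputed] -/
def prodIQJoshiEquiv (z : T.Label → 𝔇.Arith) : 𝔇.prodIQJoshiAt IQ z ≃ₗ[𝕜]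
    (∀ j : T.LabelStar, 𝔇.adelicH1eQ IQ (𝔇.capsEntry z j.1 (T.selfIndex j.1))) :=
  (𝔇.prodSwap 𝕜 IQ z).trans (LinearEquiv.piCongrRight fun _ => (𝔇.regroup 𝕜 IQ _).symm)

/-- Prop. 9.4.9.3's identification on components: the `w`-component of the `j`-th adelic class is the
`(p, j, w)`-coordinate, `p` the prime under `w`. [folklore] -/
@[simp] theorem prodIQJoshiEquiv_apply (z : T.Label → 𝔇.Arith) (x : 𝔇.prodIQJoshiAt IQ z) (j : T.LabelStar)
    (w : T.V) : 𝔇.prodIQJoshiEquiv 𝕜 IQ z x j w = x (T.over w) j (T.toFibre w) := rfl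

/-- Prop. 9.4.9.3 at the integral level ((9.4.9.4) first equality: "`𝓘̃_Joshi = ∏_{j=1}^{ℓ*} H^1_e(arith(L')_{y_j},
ℤ(1))`"): the identification matches `𝓘̃_Joshi` with the product of the integral adelic `H^1_e`'s of Def. 9.4.2.3 —
PROVED. [claim: Joshi2024ATS3, status: disputed] -/
theorem prodIQJoshiEquiv_mem_iff (z : T.Label → 𝔇.Arith) (x : 𝔇.prodIQJoshiAt IQ z) :
    (∀ j : T.LabelStar, 𝔇.prodIQJoshiEquiv 𝕜 IQ z x j ∈ 𝔇.adelicH1e IQ I (𝔇.capsEntry z j.1 (T.selfIndex j.1))) ↔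
      x ∈ 𝔇.prodIJoshiAt IQ I z := by
  simp only [prodIJoshiAt, localPacket, adelicH1e, AddSubgroup.mem_pi, Set.mem_univ, true_implies,
    prodIQJoshiEquiv_apply]
  constructor
  · intro h p j w
    obtain ⟨w, rfl⟩ := w
    exact h j w
  · intro h j w
    exact h (T.over w) j (T.toFibre w)

/-- [J-III] Proposition 9.4.9.3, the "`≃`" halves of (9.4.9.4)/(9.4.9.5) at the standard tuple `z_Θ` (p.106
l.36–54): "`∏_{j=1}^{ℓ*} H^1_e(arith(L')_{y_j}, ℚ(1)) ≃ H^1_e(arith(L')_{y_{ℓ*}}, ℚ(1))^{ℓ*}`", CONSTRUCTED from the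
amphoric isomorphisms of Rmk. 9.4.8.2 taken as a PARAMETER (p.106 l.28: "This discussion together with
Proposition 9.4.2.4 and Theorem 10.11.3.1 leads to the following explicit description").
[claim: Joshi2024ATS3, status: disputed] -/
def prop9493Equiv
    (amph : ∀ (j : T.LabelStar) (w : T.V), IQ (𝔇.zTheta j.1) w ≃ₗ[𝕜] IQ (𝔇.zTheta (lstarLabel T).1) w) :
    𝔇.prodIQJoshiAt IQ 𝔇.zTheta ≃ₗ[𝕜] (T.LabelStar → 𝔇.adelicH1eQ IQ (𝔇.zTheta (lstarLabel T).1)) :=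
  (𝔇.prodIQJoshiEquiv 𝕜 IQ 𝔇.zTheta).trans
    (LinearEquiv.piCongrRight fun j => LinearEquiv.piCongrRight fun w => amph j w)

/-! ## 4. §9.4.10: expanding the tensor product over the direct sums, (9.4.10.1) -/

/-- [J-III] §9.4.10, (9.4.10.1) (p.106 l.61–86): "expanding out the tensor product (9.4.6.2) for `^{S_{j+1}}𝓘_p` one
gets `⊗_{a∈S_{ℓ*+1}} 𝓘^{ℚ_p}_p = ⊗_{a∈S_{ℓ*+1}} ( ⊕_{w|p} L'_w ) = ⊕_α E''_α` where `E''_α` runs over a multi-set of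
p-adic fields" — the algebraic content PROVED for every label `j` and any carriers: the `(j+1)`-fold tensor product
distributes over the finite direct sums, the summands being indexed by the collections `(w_a)_{a∈S_{j+1}}`,
`w_a ∈ V_p` (the twin of OUR `Literature.IUT.LogThetaLattice.packetDecomposition`, [IUTchIII] Prop. 3.1
display). That each summand `⊗_a L'_{w_a}` splits further into p-adic FIELDS is [IUTchIII] Prop. 3.1 (i)
(`Prop31i_ringStructures`, named there, not used here). [claim: Joshi2024ATS3, status: disputed] -/
def packetQDecomposition (z : T.Label → 𝔇.Arith) (j : T.Label) (p : T.VQ) :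
    𝔇.packetQ 𝕜 IQ z j p ≃ₗ[𝕜]
      (∀ α : T.Caps j → T.Fibre p, ⨂[𝕜] a : T.Caps j, IQ (𝔇.capsEntry z j a) (α a).1) :=
  (PiTensorProduct.congr fun a =>
      (DirectSum.linearEquivFunOnFintype 𝕜 (T.Fibre p) fun w => IQ (𝔇.capsEntry z j a) w.1).symm).trans <|
    (PiTensorProduct.ofDirectSumEquiv (R := 𝕜)
        (M := fun (a : T.Caps j) (w : T.Fibre p) => IQ (𝔇.capsEntry z j a) w.1)).trans
      (DirectSum.linearEquivFunOnFintype 𝕜 (T.Caps j → T.Fibre p) fun α =>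
        ⨂[𝕜] a : T.Caps j, IQ (𝔇.capsEntry z j a) (α a).1)

/-- On pure tensors (9.4.10.1) is the evident map `⊗_a (x_{a,w})_w ↦ ( (w_a)_a ↦ ⊗_a x_{a,w_a} )`. [folklore] -/
theorem packetQDecomposition_tprod (z : T.Label → 𝔇.Arith) (j : T.Label) (p : T.VQ)
    (x : 𝔇.prodPacketQ IQ z j p) (α : T.Caps j → T.Fibre p) :
    𝔇.packetQDecomposition 𝕜 IQ z j p (PiTensorProduct.tprod 𝕜 x) α =
      PiTensorProduct.tprod 𝕜 fun a => x a (α a) := by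
  simp only [packetQDecomposition, LinearEquiv.trans_apply, PiTensorProduct.congr_tprod,
    DirectSum.linearEquivFunOnFintype_apply]
  rw [PiTensorProduct.ofDirectSumEquiv_tprod_apply]
  rfl

/-! ## 5. All-label variant of the codomain (interface totality for S's `∀ j : T.Label`; appended) -/

/-- The ALL-LABEL codomain `∏_p ∏_{j=0}^{ℓ*} ^{S_{j+1}}𝓘^{ℚ_p}_p(L')`: print's `𝓘^ℚ_Mochizuki(L')` ((9.4.6.8), `∏_{j=1}^{ℓ*}`) WITH the
extra `j = 0` factor `^{S_1}𝓘^{ℚ_p}_p(L') = 𝓘^{ℚ_p}_p(L')_{z_0}` — a packet §9.4.5/§9.4.6 DO define (`S_1(z) = {z_0}`, p.103 l.10;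
(9.4.6.2) for `A = S_{j+1}(z)`) but (9.4.6.8) does not include. OUR EXTENSION for interface totality only (flag F4; E-t22
RQ7 INFO 1 on p429434: S, `Cor312.Setting.possibleImages` and `Joshi.LociReading.proj` range over all `j : T.Label`);
`restrictStar` recovers print's codomain. [folklore] -/
abbrev IQMochizukiAllAt (z : T.Label → 𝔇.Arith) : Type := ∀ (p : T.VQ) (j : T.Label), 𝔇.packetQ 𝕜 IQ z j p

/-- Its integral structure `∏_p ∏_{j=0}^{ℓ*} ^{S_{j+1}}𝓘_p(L')` (OUR EXTENSION, as above). [folklore] -/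
def IMochizukiAllAt (z : T.Label → 𝔇.Arith) : AddSubgroup (𝔇.IQMochizukiAllAt 𝕜 IQ z) :=
  AddSubgroup.pi Set.univ fun p => AddSubgroup.pi Set.univ fun j => 𝔇.packet 𝕜 IQ I z j p

/-- Forgetting the `j = 0` factor: the all-label codomain onto print's `𝓘^ℚ_Mochizuki(L')` ((9.4.6.8)). [folklore] -/
def restrictStar (z : T.Label → 𝔇.Arith) : 𝔇.IQMochizukiAllAt 𝕜 IQ z →ₗ[𝕜] 𝔇.IQMochizukiAt 𝕜 IQ z where
  toFun x p j := x p j.1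
  map_add' _ _ := rfl
  map_smul' _ _ := rfl

/-- `restrictStar` is surjective (extend by `0` at `j = 0`). [folklore] -/
theorem restrictStar_surjective (z : T.Label → 𝔇.Arith) : Function.Surjective (𝔇.restrictStar 𝕜 IQ z) := by
  classical
  intro y
  refine ⟨fun p j => if h : j = 0 then 0 else y p ⟨j, h⟩, ?_⟩
  funext p j
  obtain ⟨j, hj⟩ := j
  show (if h : j = 0 then 0 else y p ⟨j, h⟩) = y p ⟨j, hj⟩
  rw [dif_neg hj]

/-- `restrictStar` carries the all-label integral structure into `𝓘_Mochizuki(L')`. [folklore] -/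
theorem restrictStar_mem (z : T.Label → 𝔇.Arith) (x : 𝔇.IQMochizukiAllAt 𝕜 IQ z) (hx : x ∈ 𝔇.IMochizukiAllAt 𝕜 IQ I z) :
    𝔇.restrictStar 𝕜 IQ z x ∈ 𝔇.IMochizukiAt 𝕜 IQ I z := by
  simp only [IMochizukiAllAt, IMochizukiAt, AddSubgroup.mem_pi, Set.mem_univ, true_implies] at hx ⊢
  exact fun p j => hx p j.1

/-- Per-packet SHADOWS of a subset of the all-label codomain, indexed like S's region families `(j, v_ℚ) ↦ …`: the image
under the coordinate projection to the packet `(j, p)` (OUR READING, cf. `packetShadows`). [folklore] -/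
def shadowFamily {z : T.Label → 𝔇.Arith} (X : Set (𝔇.IQMochizukiAllAt 𝕜 IQ z)) (j : T.Label) (p : T.VQ) :
    Set (𝔇.packetQ 𝕜 IQ z j p) :=
  (fun x => x p j) '' X

/-- Shadows at a nonzero label agree with `packetShadows` of the image in print's codomain. [folklore] -/
theorem shadowFamily_eq_packetShadows {z : T.Label → 𝔇.Arith} (X : Set (𝔇.IQMochizukiAllAt 𝕜 IQ z)) (j : T.LabelStar)
    (p : T.VQ) : 𝔇.shadowFamily 𝕜 IQ X j.1 p = 𝔇.packetShadows (𝔇.restrictStar 𝕜 IQ z '' X) p j := by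
  simp only [shadowFamily, packetShadows, Set.image_image]
  rfl

/-- D-09, all labels: under the strictification `ofLogShells L` the all-label codomain IS `∀ p (j : T.Label), L.Packet j p`
and `shadowFamily X : ∀ (j : T.Label) (vQ : T.VQ), Set (L.Packet j vQ)` has EXACTLY the type of the region families
`ρ qK`, `ρ D'.Ψ` compared by S = `Cor312Vol.PilotKummerIndRelated` (definitionally). [folklore] -/
theorem IQMochizukiAllAt_ofLogShells (L : LogShells T) (z : T.Label → 𝔇.Arith) :
    𝔇.IQMochizukiAllAt ℚ (𝔇.ofLogShells L) z = ∀ (p : T.VQ) (j : T.Label), L.Packet j p := rfl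

end Carriers

end TensorPacketDatum

end Summit.ABC.IUTFork.Joshi

end
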